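import Summits.ABC.ABC.Theorems.TwistAmplificationSharpModerateLawCornerHallCalibrationLemmas

/-!
# Crux `TwistAmplification.SharpModerateLaw` (stmt-ABC-1975), line `unit-plane-conic-two-torsion`:
calibration of the open Hall corner `stub_cornerHall`

Registered sub-goal `strongHallCount_of_cornerHallLaw : CornerHallLaw6 → StrongHallCount` (objects of
`…SharpModerateLawUnitPlaneFlat6Defs.lean`): the cone law on the scale-free twist-aware Hall corner
`CornerHallTw` (`|Disc F|·m²·g³ ≤ 432·√(2Y)`, statement `CornerHallLaw6 = LawWithConeE CornerHallTw 1` of the open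
stub `stub_cornerHall`) implies that the STRONG HALL NEAR-MISSES
`{(u, v) : 0 < u ≤ U, u squarefree, (u, 6) = 1, u³ ≠ v², 72|u³ − v²| ≤ √u}` number `≤ C_ε · U^ε` for every `ε > 0`
— a statement strictly below the one-variable square-root barrier, which is therefore what the corner costs.
The proof is the cousin of the sibling line's `nearCuspSqrtCount_of_hallRegimeLaw` (`…HallCalibration.lean`),
run through this line's dictionary; the injection of one cell of the family into the Hall-corner data is
`hallCell_le_totalCount` (`…CornerHallCalibrationLemmas.lean`).

Proof. CONE AND SIZE at the cell scales `X = 72√U`, `Y = 186624·72⁶U³/2` (`cone_scale`, `bound_scale`, `σ = 7`,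
law exponent `ε/4`): `X³ ≤ 2Y`, `Y ≤ 186624·X⁷`, `X·Y^{−1/6} ≤ 1` (`X⁶ ≤ Y`) and
`(XY)^{ε/4} ≤ (K·U⁴)^{ε/4} = K^{ε/4}·U^ε`, so a cell `U/2^{1/3} ≤ u < U` (`U ≥ 4`) holds `≤ max(C₀, 0)·2K^{ε/4}·U^ε`
pairs. SUM: with the strict family `G(U) = {u < U, …}` (finite, `famLt_finite`),
`#G(U) ≤ #G(U/2^{1/3}) + #cell(U)` and induction over the scales `2^{n/3}` with the geometric weight
`ρ = 2^{ε/3} > 1` give `#G(U) ≤ A·U^ε + #G(4)`; finally `{u ≤ U} ⊆ G(2U)` and `(2U)^ε = 2^ε·U^ε`.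
-/

noncomputable section

-- the mandated summit namespace `Summit.ABC.ABC` (summit = problem) trips the duplicate-namespace linter
set_option linter.dupNamespace false

namespace Summit.ABC.ABC.Theorems.SharpModerateLaw.UnitPlane

/-! ## 1. Cone and size of the law at the cell scales -/

/-- **Cone.** The cell scales `X = 72√U`, `Y = 186624·72⁶U³/2` (`U ≥ 1`) satisfy `X, Y ≥ 1`, `X³ ≤ 2Y`,
`Y ≤ 186624·X⁷`. -/
theorem cone_scale {U : ℝ} (hU : 1 ≤ U) :
    1 ≤ 72 * Real.sqrt U ∧ 1 ≤ 186624 * (69657034752 * U ^ 3) ∧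
      (72 * Real.sqrt U) ^ 3 ≤ 2 * (186624 * (69657034752 * U ^ 3)) ∧
      186624 * (69657034752 * U ^ 3) ≤ 186624 * (72 * Real.sqrt U) ^ (7 : ℝ) := by
  have hU0 : 0 ≤ U := by linarith
  have hs1 : 1 ≤ Real.sqrt U := Real.one_le_sqrt.mpr hU
  have hsq : Real.sqrt U ^ 2 = U := Real.sq_sqrt hU0
  have hsU : Real.sqrt U ≤ U := by nlinarith
  have hU3 : 1 ≤ U ^ 3 := one_le_pow₀ hU
  refine ⟨by linarith, by linarith, ?_, ?_⟩
  · have e : (72 * Real.sqrt U) ^ 3 = 373248 * U * Real.sqrt U := by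
      rw [mul_pow, show Real.sqrt U ^ 3 = Real.sqrt U ^ 2 * Real.sqrt U by ring, hsq]; ring
    rw [e]
    have h1 : U * Real.sqrt U ≤ U * U := mul_le_mul_of_nonneg_left hsU hU0
    have h2 : U * U ≤ U ^ 3 := by nlinarith [mul_nonneg (mul_nonneg hU0 hU0) (sub_nonneg.mpr hU)]
    linarith
  · rw [show (7 : ℝ) = ((7 : ℕ) : ℝ) by norm_num, Real.rpow_natCast]
    have e : (72 * Real.sqrt U) ^ 7 = 10030613004288 * U ^ 3 * Real.sqrt U := by
      rw [mul_pow, show Real.sqrt U ^ 7 = (Real.sqrt U ^ 2) ^ 3 * Real.sqrt U by ring, hsq]; ring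
    rw [e]
    nlinarith [mul_le_mul_of_nonneg_left hs1 (by positivity : (0 : ℝ) ≤ U ^ 3)]

/-- **Size of the law at the cell scales** (exponent `ε/4`): `(XY)^{ε/4}·(X·Y^{−1/6} + 1) ≤ K·U^ε` for `U ≥ 1`,
with `K = 2·(72·186624·72⁶/2)^{ε/4}`: `XY ≤ (72·186624·72⁶/2)·U⁴`, `(U⁴)^{ε/4} = U^ε`, and `X⁶ = 72⁶U³ ≤ Y` gives
`X·Y^{−1/6} ≤ X·X^{−1} = 1`. -/
theorem bound_scale {ε : ℝ} (hε : 0 < ε) : ∃ K : ℝ, 0 ≤ K ∧ ∀ U : ℝ, 1 ≤ U →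
    (72 * Real.sqrt U * (186624 * (69657034752 * U ^ 3))) ^ (ε / 4) *
      (72 * Real.sqrt U * (186624 * (69657034752 * U ^ 3)) ^ (-(1 / 6 : ℝ)) + 1) ≤ K * U ^ ε := by
  refine ⟨2 * (72 * (186624 * 69657034752) : ℝ) ^ (ε / 4), by positivity, fun U hU => ?_⟩
  have hU0 : 0 < U := by linarith
  have hs1 : 1 ≤ Real.sqrt U := Real.one_le_sqrt.mpr hU
  have hs0 : 0 < Real.sqrt U := by linarith
  have hsq : Real.sqrt U ^ 2 = U := Real.sq_sqrt hU0.le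
  have hsU : Real.sqrt U ≤ U := by nlinarith
  have hX0 : 0 < 72 * Real.sqrt U := by linarith
  -- `(XY)^{ε/4} ≤ K₁^{ε/4}·U^ε`
  have h1 : (72 * Real.sqrt U * (186624 * (69657034752 * U ^ 3))) ^ (ε / 4) ≤
      (72 * (186624 * 69657034752) : ℝ) ^ (ε / 4) * U ^ ε := by
    have hle : 72 * Real.sqrt U * (186624 * (69657034752 * U ^ 3)) ≤ 72 * (186624 * 69657034752) * U ^ 4 := by
      nlinarith [mul_le_mul_of_nonneg_right hsU (by positivity : (0 : ℝ) ≤ U ^ 3)]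
    calc (72 * Real.sqrt U * (186624 * (69657034752 * U ^ 3))) ^ (ε / 4)
        ≤ (72 * (186624 * 69657034752) * U ^ 4) ^ (ε / 4) := Real.rpow_le_rpow (by positivity) hle (by positivity)
      _ = (72 * (186624 * 69657034752) : ℝ) ^ (ε / 4) * (U ^ 4) ^ (ε / 4) := Real.mul_rpow (by norm_num) (by positivity)
      _ = (72 * (186624 * 69657034752) : ℝ) ^ (ε / 4) * U ^ ε := by
          rw [← Real.rpow_natCast U 4, ← Real.rpow_mul hU0.le]
          congr 2; push_cast; ring
  -- `X·Y^{−1/6} ≤ 1`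
  have h2 : 72 * Real.sqrt U * (186624 * (69657034752 * U ^ 3)) ^ (-(1 / 6 : ℝ)) ≤ 1 := by
    have hX6 : (72 * Real.sqrt U) ^ 6 ≤ 186624 * (69657034752 * U ^ 3) := by
      rw [mul_pow, show Real.sqrt U ^ 6 = (Real.sqrt U ^ 2) ^ 3 by ring, hsq]
      nlinarith [pow_pos hU0 3]
    have h : (186624 * (69657034752 * U ^ 3)) ^ (-(1 / 6 : ℝ)) ≤ ((72 * Real.sqrt U) ^ 6) ^ (-(1 / 6 : ℝ)) :=
      Real.rpow_le_rpow_of_nonpos (by positivity) hX6 (by norm_num)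
    have e : ((72 * Real.sqrt U) ^ 6) ^ (-(1 / 6 : ℝ)) = (72 * Real.sqrt U)⁻¹ := by
      rw [← Real.rpow_natCast (72 * Real.sqrt U) 6, ← Real.rpow_mul hX0.le, ← Real.rpow_neg_one]
      congr 1; push_cast; ring
    calc 72 * Real.sqrt U * (186624 * (69657034752 * U ^ 3)) ^ (-(1 / 6 : ℝ))
        ≤ 72 * Real.sqrt U * (72 * Real.sqrt U)⁻¹ := mul_le_mul_of_nonneg_left (h.trans_eq e) hX0.le
      _ = 1 := mul_inv_cancel₀ hX0.ne'
  have hpos : 0 ≤ 72 * Real.sqrt U * (186624 * (69657034752 * U ^ 3)) ^ (-(1 / 6 : ℝ)) + 1 := by positivity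
  calc (72 * Real.sqrt U * (186624 * (69657034752 * U ^ 3))) ^ (ε / 4) *
        (72 * Real.sqrt U * (186624 * (69657034752 * U ^ 3)) ^ (-(1 / 6 : ℝ)) + 1)
      ≤ ((72 * (186624 * 69657034752) : ℝ) ^ (ε / 4) * U ^ ε) * 2 := mul_le_mul h1 (by linarith) hpos (by positivity)
    _ = 2 * (72 * (186624 * 69657034752) : ℝ) ^ (ε / 4) * U ^ ε := by ring

/-! ## 2. The strict family is finite; the calibration theorem -/

/-- The strict family `{0 < u < U, …, 72|u³ − v²| ≤ √u}` is finite (inside the sibling's family `2|u³ − v²| ≤ √u`,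
`u ≤ U`, `CuspDispersion.fam_finite`). -/
theorem famLt_finite (U : ℝ) :
    {q : ℤ × ℤ | 0 < q.1 ∧ (q.1 : ℝ) < U ∧ Squarefree q.1 ∧ IsCoprime q.1 6 ∧ q.1 ^ 3 ≠ q.2 ^ 2 ∧
      (72 * |q.1 ^ 3 - q.2 ^ 2| : ℝ) ≤ Real.sqrt q.1}.Finite := by
  refine (CuspDispersion.fam_finite U).subset ?_
  rintro q ⟨hu, huU, hsq, hcop, hne, hh⟩
  refine ⟨hu, huU.le, hsq, hcop, hne, le_trans ?_ hh⟩
  have h0 : (0 : ℝ) ≤ |(q.1 : ℝ) ^ 3 - (q.2 : ℝ) ^ 2| := abs_nonneg _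
  push_cast
  linarith

/-- **Calibration of `stub_cornerHall` (registered sub-goal `strongHallCount_of_cornerHallLaw` of stmt-ABC-1975):
the Hall-corner law implies that strong Hall near-misses are sparse.** If `CornerHallLaw6 = LawWithConeE CornerHallTw 1`
holds, then for every `ε > 0` there is `C` with
`#{(u, v) ∈ ℤ² : 0 < u ≤ U, u squarefree, (u, 6) = 1, u³ ≠ v², 72|u³ − v²| ≤ √u} ≤ C·U^ε` for all `U ≥ 1`.
Proof: the law at `σ = 7`, exponent `ε/4`; a cell `U/2^{1/3} ≤ u < U` (`U ≥ 4`) of the strict family `G(U)` injects by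
`(u, v) ↦ (72²u, 72³v)` and the dictionary into the Hall-corner data at `(72√U, 186624·72⁶U³/2)`
(`hallCell_le_totalCount`), of total count `≤ max(C₀, 0)·K·U^ε` (`cone_scale`, `bound_scale`); scales `U ≤ 4` are inside
the finite set `G(4)`; induction over `U ≤ 2^{n/3}` with `A = cρ/(ρ − 1)`, `ρ = 2^{ε/3}`, `c = max(C₀, 0)·K`; finally
`{u ≤ U} ⊆ G(2U)` and `(2U)^ε = 2^ε·U^ε`. -/
theorem strongHallCount_of_cornerHallLaw : CornerHallLaw6 → StrongHallCount := by
  intro hlaw ε hε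
  -- the strict family
  set G : ℝ → Set (ℤ × ℤ) := fun U : ℝ => {q : ℤ × ℤ | 0 < q.1 ∧ (q.1 : ℝ) < U ∧ Squarefree q.1 ∧
    IsCoprime q.1 6 ∧ q.1 ^ 3 ≠ q.2 ^ 2 ∧ (72 * |q.1 ^ 3 - q.2 ^ 2| : ℝ) ≤ Real.sqrt q.1} with hG
  have hfin : ∀ U : ℝ, (G U).Finite := fun U => famLt_finite U
  obtain ⟨C₀, hC₀⟩ := hlaw 7 (by norm_num) (ε / 4) (by positivity)
  obtain ⟨K, hK0, hK⟩ := bound_scale hε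
  -- constants
  set C : ℝ := max C₀ 0 with hC
  have hC0 : 0 ≤ C := le_max_right _ _
  have hCC : C₀ ≤ C := le_max_left _ _
  set b : ℝ := (2 : ℝ) ^ (1 / 3 : ℝ) with hb
  have hb1 : 1 < b := Real.one_lt_rpow one_lt_two (by norm_num)
  have hb0 : 0 < b := by linarith
  have hb3 : b ^ 3 = 2 := by
    rw [hb, ← Real.rpow_mul_natCast zero_le_two]; norm_num
  set ρ : ℝ := b ^ ε with hρ
  have hρ1 : 1 < ρ := Real.one_lt_rpow hb1 hε
  set c : ℝ := C * K with hc
  have hc0 : 0 ≤ c := mul_nonneg hC0 hK0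
  set A : ℝ := c * ρ / (ρ - 1) with hA
  have hA0 : 0 ≤ A := div_nonneg (by positivity) (by linarith)
  have halg : A / ρ + c = A := by
    have hρ' : ρ - 1 ≠ 0 := by linarith
    have hρ0 : ρ ≠ 0 := by linarith
    rw [hA]; field_simp; ring
  set B : ℝ := (Set.ncard (G 4) : ℝ) with hB
  have hB0 : 0 ≤ B := Nat.cast_nonneg _
  -- (i) small scales sit inside `G 4`
  have hsmall : ∀ U : ℝ, U ≤ 4 → (Set.ncard (G U) : ℝ) ≤ B := by
    intro U hU
    have hsub : G U ⊆ G 4 := fun q ⟨hu, huU, hrest⟩ => ⟨hu, lt_of_lt_of_le huU hU, hrest⟩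
    rw [hB]; exact_mod_cast Set.ncard_le_ncard hsub (hfin 4)
  -- (ii) one cell `U/b ≤ u < U`, `U ≥ 4`, via the law at `(72√U, 186624·72⁶U³/2)`
  have hcell : ∀ U : ℝ, 4 ≤ U →
      (Set.ncard {q : ℤ × ℤ | q ∈ G U ∧ U / b ≤ (q.1 : ℝ)} : ℝ) ≤ c * U ^ ε := by
    intro U hU
    have hU1 : 1 ≤ U := by linarith
    obtain ⟨hX1, hY1, hcone1, hcone2⟩ := cone_scale hU1
    -- the cell injects into the Hall-corner data at `(72√U, 186624·72⁶U³/2)` (lemmas file)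
    have hUb : U ^ 3 ≤ 2 * (U / b) ^ 3 := by rw [div_pow, hb3]; linarith
    have h12 : Set.ncard {q : ℤ × ℤ | q ∈ G U ∧ U / b ≤ (q.1 : ℝ)} ≤
        totalCount (CornerHallTw (ε / 4)) (72 * Real.sqrt U) (186624 * (69657034752 * U ^ 3)) :=
      hallCell_le_totalCount (ε / 4) U (U / b) (by linarith) (div_nonneg (by linarith) hb0.le) hUb
    have hbound := hK U hU1
    have hlawU := hC₀ (72 * Real.sqrt U) (186624 * (69657034752 * U ^ 3)) hX1 hY1 hcone1 hcone2
    have hnn : 0 ≤ (72 * Real.sqrt U * (186624 * (69657034752 * U ^ 3))) ^ (ε / 4) *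
        (72 * Real.sqrt U * (186624 * (69657034752 * U ^ 3)) ^ (-(1 / 6 : ℝ)) + 1) := by positivity
    calc (Set.ncard {q : ℤ × ℤ | q ∈ G U ∧ U / b ≤ (q.1 : ℝ)} : ℝ)
        ≤ (totalCount (CornerHallTw (ε / 4)) (72 * Real.sqrt U) (186624 * (69657034752 * U ^ 3)) : ℝ) := by
          exact_mod_cast h12
      _ ≤ C₀ * (72 * Real.sqrt U * (186624 * (69657034752 * U ^ 3))) ^ (ε / 4) *
            (72 * Real.sqrt U * (186624 * (69657034752 * U ^ 3)) ^ (-(1 / 6 : ℝ)) + 1) := hlawU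
      _ ≤ C * ((72 * Real.sqrt U * (186624 * (69657034752 * U ^ 3))) ^ (ε / 4) *
            (72 * Real.sqrt U * (186624 * (69657034752 * U ^ 3)) ^ (-(1 / 6 : ℝ)) + 1)) := by
          rw [mul_assoc]; exact mul_le_mul_of_nonneg_right hCC hnn
      _ ≤ C * (K * U ^ ε) := mul_le_mul_of_nonneg_left hbound hC0
      _ = c * U ^ ε := by rw [hc]; ring
  -- (iii) induction over the scales `U ≤ b^n`
  have key : ∀ n : ℕ, ∀ U : ℝ, 1 ≤ U → U ≤ b ^ n → (Set.ncard (G U) : ℝ) ≤ A * U ^ ε + B := by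
    intro n
    induction n with
    | zero =>
      intro U hU1 hUn
      have hAU : 0 ≤ A * U ^ ε := mul_nonneg hA0 (Real.rpow_nonneg (by linarith) _)
      rw [pow_zero] at hUn
      have h := hsmall U (by linarith)
      linarith
    | succ n ih =>
      intro U hU1 hUn
      have hAU : 0 ≤ A * U ^ ε := mul_nonneg hA0 (Real.rpow_nonneg (by linarith) _)
      rcases le_or_gt U 4 with hle | hgt
      · have h := hsmall U hle
        linarith
      · have hU0 : 0 ≤ U := by linarith
        have hUb1 : 1 ≤ U / b := by
          rw [le_div_iff₀ hb0]
          have hb2 : b ≤ 2 := by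
            have h := Real.rpow_le_rpow_of_exponent_le one_le_two (show (1 / 3 : ℝ) ≤ 1 by norm_num)
            rw [Real.rpow_one] at h
            rw [hb]; exact h
          linarith
        have hUbn : U / b ≤ b ^ n := by rw [div_le_iff₀ hb0, ← pow_succ]; exact hUn
        have hsplit : G U ⊆ G (U / b) ∪ {q : ℤ × ℤ | q ∈ G U ∧ U / b ≤ (q.1 : ℝ)} := by
          intro q hq
          rcases lt_or_ge (q.1 : ℝ) (U / b) with h | h
          · exact Or.inl ⟨hq.1, h, hq.2.2⟩
          · exact Or.inr ⟨hq, h⟩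
        have hfin' : (G (U / b) ∪ {q : ℤ × ℤ | q ∈ G U ∧ U / b ≤ (q.1 : ℝ)}).Finite :=
          (hfin _).union ((hfin U).subset fun q hq => hq.1)
        have h1 := Set.ncard_le_ncard hsplit hfin'
        have h2 := Set.ncard_union_le (G (U / b)) {q : ℤ × ℤ | q ∈ G U ∧ U / b ≤ (q.1 : ℝ)}
        have h3 : (Set.ncard (G U) : ℝ) ≤ (Set.ncard (G (U / b)) : ℝ) +
            (Set.ncard {q : ℤ × ℤ | q ∈ G U ∧ U / b ≤ (q.1 : ℝ)} : ℝ) := by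
          exact_mod_cast h1.trans h2
        have hdiv : (U / b) ^ ε = U ^ ε / ρ := by rw [hρ, Real.div_rpow hU0 hb0.le]
        calc (Set.ncard (G U) : ℝ) ≤ (A * (U / b) ^ ε + B) + c * U ^ ε := by
              linarith [ih (U / b) hUb1 hUbn, hcell U hgt.le]
          _ = (A / ρ + c) * U ^ ε + B := by rw [hdiv]; ring
          _ = A * U ^ ε + B := by rw [halg]
  -- (iv) conclusion: `{u ≤ U} ⊆ G (2U)`
  refine ⟨A * (2 : ℝ) ^ ε + B, fun U hU => ?_⟩
  have h2U : 1 ≤ 2 * U := by linarith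
  obtain ⟨n, hn⟩ := pow_unbounded_of_one_lt (2 * U) hb1
  have h1 := key n (2 * U) h2U hn.le
  have hsub : {q : ℤ × ℤ | 0 < q.1 ∧ (q.1 : ℝ) ≤ U ∧ Squarefree q.1 ∧ IsCoprime q.1 6 ∧ q.1 ^ 3 ≠ q.2 ^ 2 ∧
      (72 * |q.1 ^ 3 - q.2 ^ 2| : ℝ) ≤ Real.sqrt q.1} ⊆ G (2 * U) :=
    fun q ⟨hu, huU, hrest⟩ => ⟨hu, by linarith, hrest⟩
  have h3 : (Set.ncard {q : ℤ × ℤ | 0 < q.1 ∧ (q.1 : ℝ) ≤ U ∧ Squarefree q.1 ∧ IsCoprime q.1 6 ∧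
      q.1 ^ 3 ≠ q.2 ^ 2 ∧ (72 * |q.1 ^ 3 - q.2 ^ 2| : ℝ) ≤ Real.sqrt q.1} : ℝ) ≤ (Set.ncard (G (2 * U)) : ℝ) := by
    exact_mod_cast Set.ncard_le_ncard hsub (hfin _)
  have h4 : (2 * U) ^ ε = (2 : ℝ) ^ ε * U ^ ε := Real.mul_rpow (by norm_num) (by linarith)
  have h5 : 1 ≤ U ^ ε := Real.one_le_rpow hU hε.le
  calc (Set.ncard {q : ℤ × ℤ | 0 < q.1 ∧ (q.1 : ℝ) ≤ U ∧ Squarefree q.1 ∧ IsCoprime q.1 6 ∧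
        q.1 ^ 3 ≠ q.2 ^ 2 ∧ (72 * |q.1 ^ 3 - q.2 ^ 2| : ℝ) ≤ Real.sqrt q.1} : ℝ)
      ≤ A * (2 * U) ^ ε + B := h3.trans h1
    _ = A * (2 : ℝ) ^ ε * U ^ ε + B := by rw [h4]; ring
    _ ≤ A * (2 : ℝ) ^ ε * U ^ ε + B * U ^ ε := by nlinarith
    _ = (A * (2 : ℝ) ^ ε + B) * U ^ ε := by ring

end Summit.ABC.ABC.Theorems.SharpModerateLaw.UnitPlane

end
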